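import Summits.ResolutionOfSingularities.ResolutionOfSingularities.Theorems.FrobeniusLadderFInjectiveMacaulayficationLocalFullificationFibreGe4
import Summits.ResolutionOfSingularities.ResolutionOfSingularities.Theorems.FrobeniusLadderFInjectiveMacaulayficationLocalFullificationDimFourFibreSplit
import Summits.ResolutionOfSingularities.ResolutionOfSingularities.Theorems.FrobeniusLadderFInjectiveMacaulayficationFTemkinClosedPoints
import Summits.ResolutionOfSingularities.ResolutionOfSingularities.Theorems.FrobeniusLadderFInjectiveMacaulayficationRegularBlowupModelDim2
import Summits.ResolutionOfSingularities.ResolutionOfSingularities.Theorems.FrobeniusLadderFInjectiveMacaulayficationLocalBlowupDesingularizationDimThree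
import Literature.AlgebraicGeometry.Resolution.BlowupsComposition
import Literature.AlgebraicGeometry.Resolution.BlowupsExistence
import HarnessLib.Audit
import HarnessLib

/-!
# The CM / F SPLIT of the d-UNIFORM local residue (LF) `LocalFullificationFibreGe4`: `… ↔ LocalMacaulayficationFibreGe4 ∧ LocalFInjectivizationFibreGe4`
# (crux `FInjectiveMacaulayfication` stmt-ResolutionOfSingularities-15315, chain w45a; res-L1-w45a-plan-1 RULINGS R17.4 (E9) / R17.5 (2) «the `Ge4` twin of
# the split, same substitution» — the d = 4 split is res-L1-w45a-stub-2's `…LocalFullificationDimFourFibreSplit` (p587643); seat res-L1-w45a-stub-1 g7)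

[OURS · L1 W4.5a] Support file (`--supports stmt-ResolutionOfSingularities-15315 --as helper`); two `Prop`-valued CANDIDATE statements of OURS (`@[conjecture] def`,
consumed only as hypotheses; no instance, no notation, no named fact) and ONE proved equivalence; replaces the role of NO printed item; NOT a statement of
the manuscript; AI-written (AI review is weaker than expert review).

* `LocalMacaulayficationFibreGe4` (the CM-HALF): the binders of (LF) `LocalFullificationFibreGe4.LocalFullificationFibreGe4` VERBATIM (`∀ d, 4 ≤ d → …`,
  local dimension `= d`); conclusion
  `∃ 𝓚 ≠ ⊥`, fibre-supported, such that every blowing up `S″ → S′` along `𝓚` has, at EVERY point, a stalk that is a DOMAIN and Cohen–Macaulay in the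
  clause sense (`SliceableCentre.CMCl`). Context (not a premise): Česnavičius 2021 Thm. 5.3 — a CM-excellent locally equidimensional `X` admits a
  Cohen–Macaulay blowing up with centre disjoint from `CM(X)` — applied to the excellent integral local blow-up scheme `S′`, whose non-CM locus lies in
  the closed fibre; KNOWN IN PRINT, not in the tree in this centre-controlled form (the tree's `CesnaviciusMacaulayfication` is the proper-birational
  variety form), hence a candidate-tagged OURS statement here.
* `LocalFInjectivizationFibreGe4` (the F-HALF): (LF) VERBATIM with ONE added hypothesis `∀ s : S′, SliceableCentre.CMCl (S′.presheaf.stalk s)` after `hreg`: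
  «a Cohen–Macaulay integral d-dimensional (`d ≥ 4`) local blow-up scheme regular off its closed fibre is FULL-ified by one fibre-supported blowing up» — THE
  open statement of the local door in every dimension.
* `localFullificationFibreGe4_iff_split : LocalFullificationFibreGe4 ↔ LocalMacaulayficationFibreGe4 ∧ LocalFInjectivizationFibreGe4` (same proof as the
  d = 4 split, `d` carried along); and the `d = 4` specialisations `…DimFourFibre_of_…Ge4` onto stub-2's halves.
  `⇒`: FULL ⇒ domain ∧ CM; the F-half is (L4♭) with an idle hypothesis. `⇐`: `𝓚₁` from the CM-half; `S₁ := Bl_{𝓚₁} S′ → S′ → Spec 𝒪_{X,x}` is a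
  blowing up along a nonzero ideal sheaf (Stacks 080B `IsBlowup.exists_isBlowup_comp`; nonzero because `S₁ ≠ ∅`), regular off ITS closed fibre (off
  `supp 𝓚₁ ⊆ fibre` the blowing up is a stalk isomorphism, `RegularBlowupModelDim2.isIso_stalkMap_of_isBlowup_of_not_mem`) and CM everywhere; `𝓚₂` from
  the F-half; the composite `Bl_{𝓚₂} S₁ → S′` is ONE blowing up along a fibre-supported `𝓚 ≠ ⊥` (080B `exists_isBlowup_comp_supported` with
  `T := g⁻¹(x)`), FULL at every point, hence so is EVERY blowing up along `𝓚` (`IsBlowup.unique` + `fullCl_of_isIso_stalkMap'`).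
USE: door v36 «LocalDoor» registers `stub_localFullificationFibreGe4`; this file records KERNEL-CHECKED that its content = {CM-half (Česnavičius-shaped)} ⊔
{F-half}, so a later door can register the F-half alone once the CM-half is a named fact. ≤ S bookkeeping: F-half ≤ (LF) ≤ S by the `⇒` direction.
[candidate statements, OURS; cite: Cesnavicius2021, Thm. 5.3 (context)] [cite: StacksProject, Tag 080A; Tag 080B; Tag 085U] [cite: Temkin2008, Def. 2.2.6 (shape)]
-/

-- single-problem summit: the doubled namespace component is forced
set_option linter.dupNamespace false

noncomputable section

open AlgebraicGeometry CategoryTheory CategoryTheory.Limits Literature.AlgebraicGeometry.Resolution TopologicalSpace IsLocalRing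

namespace Summit.ResolutionOfSingularities.ResolutionOfSingularities.Theorems.FInjectiveMacaulayfication.LocalFullificationFibreGe4Split

open Summit.ResolutionOfSingularities.ResolutionOfSingularities.Theorems.FInjectiveMacaulayfication
open SliceableCentre

/-! ## §1 The two halves -/

/-- [OURS · CANDIDATE statement, not a fact] **THE CM-HALF OF (LF): local Macaulayfication in local dimension `d ≥ 4` with fibre-supported centre.**
Binders of `LocalFullificationFibreGe4` VERBATIM; conclusion: a fibre-supported `𝓚 ≠ ⊥` on `S′` such that every blowing up along `𝓚` has at every point a
stalk that is a domain and Cohen–Macaulay (clause sense). Česnavičius-shaped (arXiv:1810.04493 Thm. 5.3) — known in print, candidate OURS statement here.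
[candidate statement, OURS; cite: Cesnavicius2021, Thm. 5.3 (context)] -/
@[conjecture] def LocalMacaulayficationFibreGe4 : Prop :=
  ∀ d : ℕ, 4 ≤ d → ∀ (p : ℕ), p.Prime → ∀ (k : Type) [Field k] [CharP k p]
    (X : Scheme.{0}) (f : X ⟶ Spec (.of k)),
      IsSeparated f → LocallyOfFiniteType f → QuasiCompact f → IsIntegral X →
      ∀ x : X, ringKrullDim (X.presheaf.stalk x) = d →
      ∀ (S' : Scheme.{0}) (g : S' ⟶ Spec (X.presheaf.stalk x)) (I : (Spec (X.presheaf.stalk x)).IdealSheafData),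
        I ≠ ⊥ → IsBlowup g I →
        (∀ s : S', g.base s ≠ closedPoint (X.presheaf.stalk x) → s ∈ Scheme.regularLocus S') →
        ∃ 𝓚 : S'.IdealSheafData, 𝓚 ≠ ⊥ ∧ (∀ s ∈ (𝓚.support : Set S'), g.base s = closedPoint (X.presheaf.stalk x)) ∧
          ∀ (S'' : Scheme.{0}) (π : S'' ⟶ S'), IsBlowup π 𝓚 →
            ∀ s : S'', IsDomain (S''.presheaf.stalk s) ∧ SliceableCentre.CMCl (S''.presheaf.stalk s)

/-- [OURS · CANDIDATE statement, not a fact] **THE F-HALF OF (LF): local F-injectivization of a COHEN–MACAULAY local blow-up scheme of dimension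
`d ≥ 4`, regular off its closed fibre, by one fibre-supported blowing up.** (LF) VERBATIM with the single added hypothesis `∀ s : S′, CMCl (S′.presheaf.stalk s)`
after `hreg`. THE open statement of the local door. [candidate statement, OURS; open] -/
@[conjecture] def LocalFInjectivizationFibreGe4 : Prop :=
  ∀ d : ℕ, 4 ≤ d → ∀ (p : ℕ), p.Prime → ∀ (k : Type) [Field k] [CharP k p]
    (X : Scheme.{0}) (f : X ⟶ Spec (.of k)),
      IsSeparated f → LocallyOfFiniteType f → QuasiCompact f → IsIntegral X →
      ∀ x : X, ringKrullDim (X.presheaf.stalk x) = d →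
      ∀ (S' : Scheme.{0}) (g : S' ⟶ Spec (X.presheaf.stalk x)) (I : (Spec (X.presheaf.stalk x)).IdealSheafData),
        I ≠ ⊥ → IsBlowup g I →
        (∀ s : S', g.base s ≠ closedPoint (X.presheaf.stalk x) → s ∈ Scheme.regularLocus S') →
        (∀ s : S', SliceableCentre.CMCl (S'.presheaf.stalk s)) →
        ∃ 𝓚 : S'.IdealSheafData, 𝓚 ≠ ⊥ ∧ (∀ s ∈ (𝓚.support : Set S'), g.base s = closedPoint (X.presheaf.stalk x)) ∧
          ∀ (S'' : Scheme.{0}) (π : S'' ⟶ S'), IsBlowup π 𝓚 →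
            ∀ s : S'', SliceableCentre.FullCl p (S''.presheaf.stalk s)

/-! ## §2 Plumbing -/

/-- FULL ⇒ domain ∧ CM (clause sense). [plumbing] -/
theorem isDomain_and_cmCl_of_fullCl {p : ℕ} {A : Type} [CommRing A] (h : FullCl p A) : IsDomain A ∧ CMCl A :=
  ⟨h.1, fun d hd s hs => (h.2 d hd s hs).1⟩

/-- A blowing up of a scheme with a point, along a nonzero ideal sheaf of an INTEGRAL scheme, is nonempty; contrapositively a blowing up with
nonempty source is along a nonzero ideal sheaf. [plumbing] -/
theorem ne_bot_of_isBlowup_of_nonempty {S' S : Scheme.{0}} {g : S' ⟶ S} {J : S.IdealSheafData} (hg : IsBlowup g J) [Nonempty S'] :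
    J ≠ ⊥ := by
  rintro rfl
  exact (LocalBlowupDesingularizationDimThree.isEmpty_of_isBlowup_bot hg).false (Classical.arbitrary S')

/-! ## §3 The equivalence -/

set_option maxHeartbeats 400000 in
-- the two-step blow-up bookkeeping elaborates large terms
/-- **(LF) ↔ CM-half ∧ F-half**, in every local dimension `d ≥ 4`. See the module docstring for the proof. [OURS · folklore assembly]
[cite: StacksProject, Tag 080A; Tag 080B; Tag 085U] -/
theorem localFullificationFibreGe4_iff_split :
    LocalFullificationFibreGe4.LocalFullificationFibreGe4 ↔
      LocalMacaulayficationFibreGe4 ∧ LocalFInjectivizationFibreGe4 := by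
  constructor
  · intro h
    refine ⟨fun d hd p hp k _ _ X f hsep hft hqc hint x hx S' g I hI hg hreg => ?_,
      fun d hd p hp k _ _ X f hsep hft hqc hint x hx S' g I hI hg hreg _ => h d hd p hp k X f hsep hft hqc hint x hx S' g I hI hg hreg⟩
    obtain ⟨𝓚, h𝓚, hfib, hfull⟩ := h d hd p hp k X f hsep hft hqc hint x hx S' g I hI hg hreg
    exact ⟨𝓚, h𝓚, hfib, fun S'' π hπ s => isDomain_and_cmCl_of_fullCl (hfull S'' π hπ s)⟩
  · rintro ⟨hCM, hF⟩ d hd p hp k _ _ X f hsep hft hqc hint x hx S' g I hI hg hreg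
    haveI := hsep
    haveI := hft
    haveI := hqc
    haveI := hint
    haveI : IsLocallyNoetherian X := LocallyOfFiniteType.isLocallyNoetherian f
    -- `S′` is integral and Noetherian (proper over the Noetherian `Spec 𝒪_{X,x}`)
    haveI : IsIntegral S' := hg.isIntegral hI
    haveI : IsProper g := hg.isProper
    haveI : IsLocallyNoetherian S' := LocallyOfFiniteType.isLocallyNoetherian g
    haveI : CompactSpace S' := QuasiCompact.compactSpace_of_compactSpace g
    haveI : IsNoetherian S' := {}
    -- STEP 1: the CM-half
    obtain ⟨𝓚₁, h𝓚₁, hfib₁, hcm₁⟩ := hCM d hd p hp k X f hsep hft hqc hint x hx S' g I hI hg hreg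
    obtain ⟨S₁, π₁, hπ₁⟩ := exists_isBlowup S' 𝓚₁
    haveI : IsIntegral S₁ := hπ₁.isIntegral h𝓚₁
    haveI : IsProper π₁ := hπ₁.isProper
    haveI : IsLocallyNoetherian S₁ := LocallyOfFiniteType.isLocallyNoetherian π₁
    haveI : CompactSpace S₁ := QuasiCompact.compactSpace_of_compactSpace π₁
    haveI : IsNoetherian S₁ := {}
    -- `S₁ → Spec 𝒪_{X,x}` is a blowing up along some `I₁ ≠ ⊥`
    obtain ⟨I₁, hgI₁, -⟩ := hg.exists_isBlowup_comp hπ₁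
    have hI₁ : I₁ ≠ ⊥ := ne_bot_of_isBlowup_of_nonempty hgI₁
    -- `S₁` is regular off its closed fibre and CM everywhere
    have hreg₁ : ∀ s : S₁, (π₁ ≫ g).base s ≠ closedPoint (X.presheaf.stalk x) → s ∈ Scheme.regularLocus S₁ := by
      intro s hs
      have hs' : g.base (π₁.base s) ≠ closedPoint (X.presheaf.stalk x) := by
        rwa [Scheme.Hom.comp_base, TopCat.coe_comp, Function.comp_apply] at hs
      have hnot : π₁.base s ∉ (𝓚₁.support : Set S') := fun hmem => hs' (hfib₁ _ hmem)
      haveI := RegularBlowupModelDim2.isIso_stalkMap_of_isBlowup_of_not_mem hπ₁ s hnot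
      have hreg' : IsRegularLocalRing (S'.presheaf.stalk (π₁.base s)) := hreg _ hs'
      rw [Scheme.mem_regularLocus]
      exact IsRegularLocalRing.of_ringEquiv (asIso (π₁.stalkMap s)).commRingCatIsoToRingEquiv
    have hcm : ∀ s : S₁, CMCl (S₁.presheaf.stalk s) := fun s => (hcm₁ S₁ π₁ hπ₁ s).2
    -- STEP 2: the F-half on `S₁`
    obtain ⟨𝓚₂, h𝓚₂, hfib₂, hfull₂⟩ := hF d hd p hp k X f hsep hft hqc hint x hx S₁ (π₁ ≫ g) I₁ hI₁ hgI₁ hreg₁ hcm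
    obtain ⟨S₂, π₂, hπ₂⟩ := exists_isBlowup S₁ 𝓚₂
    haveI : IsIntegral S₂ := hπ₂.isIntegral h𝓚₂
    -- STEP 3: the composite `S₂ → S′` is ONE blowing up along a fibre-supported `𝓚`
    let T : Set S' := {s | g.base s = closedPoint (X.presheaf.stalk x)}
    have h𝓚₁T : (𝓚₁.support : Set S') ⊆ T := fun s hs => hfib₁ s hs
    have h𝓚₂T : (𝓚₂.support : Set S₁) ⊆ π₁ ⁻¹' T := by
      intro s hs
      have h := hfib₂ s hs
      rw [Scheme.Hom.comp_base, TopCat.coe_comp, Function.comp_apply] at h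
      exact h
    obtain ⟨𝓚, h𝓚, h𝓚T⟩ := IsBlowup.exists_isBlowup_comp_supported π₁ 𝓚₁ π₂ 𝓚₂ T hπ₁ h𝓚₁T hπ₂ h𝓚₂T
    have h𝓚ne : 𝓚 ≠ ⊥ := ne_bot_of_isBlowup_of_nonempty h𝓚
    refine ⟨𝓚, h𝓚ne, fun s hs => h𝓚T hs, fun S'' π hπ s => ?_⟩
    -- every blowing up along `𝓚` is isomorphic to `S₂`, which is FULL everywhere
    obtain ⟨e, -, -⟩ := hπ.unique h𝓚
    exact FTemkinClosedPoints.fullCl_of_isIso_stalkMap' p e.hom s (hfull₂ S₂ π₂ hπ₂ (e.hom s))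

/-- The two halves from (LF). [plumbing] -/
theorem split_of_localFullificationFibreGe4 (h : LocalFullificationFibreGe4.LocalFullificationFibreGe4) :
    LocalMacaulayficationFibreGe4 ∧ LocalFInjectivizationFibreGe4 :=
  localFullificationFibreGe4_iff_split.mp h

/-- (LF) from the two halves — the form a later door consumes once the CM-half is a named fact. [plumbing] -/
theorem localFullificationFibreGe4_of_split (hCM : LocalMacaulayficationFibreGe4) (hF : LocalFInjectivizationFibreGe4) :
    LocalFullificationFibreGe4.LocalFullificationFibreGe4 :=
  localFullificationFibreGe4_iff_split.mpr ⟨hCM, hF⟩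

/-! ## §4 The `d = 4` specialisations onto res-L1-w45a-stub-2's (L4♭) halves -/

/-- CM-half: `Ge4 ⇒ DimFour`. [plumbing] -/
theorem localMacaulayficationDimFourFibre_of_ge4 (h : LocalMacaulayficationFibreGe4) :
    LocalFullificationDimFourFibreSplit.LocalMacaulayficationDimFourFibre :=
  fun p hp k _ _ X f hsep hft hqc hint x hx => h 4 le_rfl p hp k X f hsep hft hqc hint x (by rw [hx]; rfl)

/-- F-half: `Ge4 ⇒ DimFour`. [plumbing] -/
theorem localFInjectivizationDimFourFibre_of_ge4 (h : LocalFInjectivizationFibreGe4) :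
    LocalFullificationDimFourFibreSplit.LocalFInjectivizationDimFourFibre :=
  fun p hp k _ _ X f hsep hft hqc hint x hx => h 4 le_rfl p hp k X f hsep hft hqc hint x (by rw [hx]; rfl)

end Summit.ResolutionOfSingularities.ResolutionOfSingularities.Theorems.FInjectiveMacaulayfication.LocalFullificationFibreGe4Split

end
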